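import Summits.Parity.GeneralizedHardyLittlewood.Theses.LeeYangFibres
import Literature.NumberTheory.Sieve.BombieriAsymptoticSieveVector

/-!
# Line `one-level-per-epsilon` — skeleton for the crux `CellParityLaw` (stmt-Parity-14109)

Route `LeeYangFibres` (Parity / GeneralizedHardyLittlewood), crux decl
`Summit.Parity.GeneralizedHardyLittlewood.Theses.LeeYangFibres.CellParityLaw` (rank 3): uniformly over
non-degenerate `d = 1` systems `Ψ` of `t` forms (`‖Ψ‖_N ≤ L`) and convex `K ⊆ [−N,N]`, the joint rough
`Ω`-cells `C_j = #{n ∈ K∩ℤ : P⁻(ψ_i(n)) > N^{1/u}, Ω(ψ_i(n)) = j_i ∀ i}` obey a WALSH law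
`C_j = (∑_S θ_S ∏_{i∈S} (−1)^{j_i+1}) · β_∞ ∏_p β_p · ∏_i A_{j_i}(N)/N + O(ε N/log^t N)`, `θ_∅ = 1`,
`|θ_S| ≤ 2`, `A_m(N) = #{m' ≤ N : P⁻(m') > N^{1/u}, Ω(m') = m}`.

Idea card `Cruxes/CellParityLaw/Ideas/one-level-per-epsilon.md` (ideator 3; triage r1: pass ×3, merge with
`section-annihilator`): run Bombieri's asymptotic sieve in its FINITE-LEVEL form (Friedlander–Iwaniec 1978 §4;
tree `Literature.NumberTheory.Sieve.Bombieri1976_asymptotic_sieve_finiteLevel_holds`, `BombieriSieve.coreV`)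
COORDINATEWISE on the `t` fibre sequences `b⁽ⁱ⁾(m) = #{n ∈ K∩ℤ : ψ_i(n) = m, ψ_k(n) ∈ cell j_k ∀ k ≠ i}`,
upgraded from `Λ_k` to `Ω`-cells by Bombieri's completeness (RIMS 1977 `P_r` law; tree: `r = 2` PROVED from the
vector theorem), and assemble the `t` one-parameter laws by induction on `t` / Walsh inversion. Accuracy on the
fibre costs ONE level `θ₀ < 1` of the fibre sequences; the level itself is the parity-free open input, typed in
CLASS-COMPARISON form (main-term free — cf. the negative `PrimeDeterminantCellsConvMomentLevelOne_refuted`, where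
an explicit-density `(A₂)` died of a secondary main term) and split by the number of conditioning forms:
`t ≤ 2` (none or one shifted rough `Ω`-cell set: Bombieri–Vinogradov rung `θ < 1/2` provable now, `θ ≥ 1/2`
Elliott–Halberstam-type) versus `t ≥ 3` (intersections of ≥ 2 shifted cell sets: open at every level).

## Stubs (registered; each `sorry` is a genuine lemma of the line) and composition

* `stub_finiteLevel : FiniteLevelStep` — E1, the ENGINE: uniform finite-level Bombieri for fibres, vector weights
  `Λ_(k)`: `∀ t u K₀ ε', ∃ θ₀ < 1, FibreClassLevel t u θ₀ → FibreLambdaLaw t u K₀ ε'` (FI 1978 §4 with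
  `y = x^{1−2δ}`, `z = x^{δ^{4/3}}`, `s = δ^{−1/3}`, level `x^{1−δ}`, `ε' ≍ δ^{1/3}`; family-uniform re-cut of the
  tree's per-sequence `core_finiteLevel`/`coreV`; errors RELATIVE to `H·X`). Size XL.
* `stub_cellCompleteness : CellCompletenessStep` — E2: `∀ t u ε, ∃ K₀ ε', FibreLambdaLaw t u K₀ ε' → FibreMassLaw t u ε`
  (Bombieri's `P_r`-distribution theorem "γ = δ on odd r, 2 − δ on even r" in finite form: moments of all
  vectors `|k| ≤ K₀`, polynomial approximation on the simplices `T_r`, `r ≤ u`, boundary layers at `u₁ = 1/u` by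
  positive majorants; tree route of `Bombieri1976_P2Distribution_of_vector` for every `r`). Size L–XL.
* `stub_pairFibreBV : PairFibreBV` — L1: `FibreClassLevel t u θ` for `t ≤ 2`, `θ < 1/2` (t = 1: lattice points of
  an interval in residue classes, trivial; t = 2: Bombieri–Vinogradov for ONE shifted rough `Ω`-cell set =
  affine image of a convolution of `≤ u` prime indicators `> N^{1/u}`: Siegel–Walfisz in one factor + bilinear
  large sieve, tree `BombieriFriedlanderIwaniecTheorem0b_holds`, `bombieri_vinogradov_holds`). PROVABLE NOW, M–L.
  (Logically the `θ ≤ 1/2` shadow of L2: `pairFibreBV_of_pairFibreLevel`; kept separate as the unconditional rung.)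
* `stub_pairFibreLevel : PairFibreLevel` — L2: the same for `1/2 ≤ θ < 1` (Elliott–Halberstam-type level for shifted
  rough `Ω`-cell sets with the maximum over two generic classes; GEH-strength, open, believed; the
  `LargeSieveLevelHalf` barrier bites on every rung here — the sibling card `composite-fibres-first` attacks the
  SIGNED form instead). Open-problem.
* `stub_multiFibreLevel : MultiFibreLevel` — L3: `FibreClassLevel t u θ` for `t ≥ 3`, `θ < 1`: relative
  equidistribution of prime-pair-type sets (intersections of ≥ 2 shifted cell sets) among generic classes on
  average over moduli — open at EVERY level, even bounded moduli (the card's honest gap; triage X2/F3). HARDEST.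
* `stub_walsh : WalshStep` — W: `FibreMassLaw t u ε (all u, ε) → (CellParityLawRelAt t' for 1 ≤ t' < t) →
  CellParityLawRelAt t`: the induction on `t` (base `t = 1` included: `θ_∅ = (γ_o + γ_e)/2 = 1`): fibre mass
  `X⁽ⁱ⁾ = cellCount` of the subsystem `Ψ₋ᵢ` on `K ∩ {ψ_i > 0}`, singular-series factorisation
  `H_i · 𝔖(Ψ₋ᵢ) = 𝔖(Ψ)(1 + O(t²N^{−1/u}))`, coordinatewise parity-dependence ⇒ Walsh form, positivity ⇒
  `|θ_S| ≤ 1 + o(1)`; triage X1 ("shared structure lemma", checked by all three triagers). PROVABLE NOW, M–L.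
* `stub_absoluteCells : AbsoluteCellsStep` — R, DECLARED RESIDUAL: `(∀ t, CellParityLawRelAt t) → CellParityLaw`.
  Found while typing (line card §Findings): the crux's error is ABSOLUTE `εN/log^t N` but
  `sup_{‖Ψ‖_N ≤ L} ∏_p β_p ≍ (log log N)^{t−1}`, while every finite level yields a fixed RELATIVE accuracy; so the
  line's own output is the relative law `CellParityLawRelAt` (yardstick `ε(1 + ∏_pβ_p)N/log^t N`) and the
  upgrade on discriminant-rich systems is the cell-level twin of the route's residual `AbsoluteUpgrade`. It is
  moot if the route consumes the relative law (`HyperbolicityClipsParity` only outputs `PrimeCellsRelative`).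
* `CellParityLaw_of : CellParityLaw` — the kernel-checked composition of the seven stubs (pure logic: choose
  `(K₀, ε')` by E2, `θ₀` by E1, feed the level from L1/L2/L3 by cases on `t` and `θ₀`, strong induction on `t`
  through W, then R), concluding the crux BY NAME; its hypothetical form is the `example` next to it.

Disproof.lean (cdisprove, read through the item's evidence notes only — `run/gate/evidence` is not mounted in
planner jails and no `Cruxes/CellParityLaw/Disproof.lean` workfile exists yet): every stub keeps the load-bearing
hypotheses `2 ≤ u` (`cellParityLaw_false_without_twoLeU`), `Convex ℝ K`, `K ⊆ realBox 1 N`, `affLinSize Ψ N ≤ L`,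
`IsNondegenerateSystem Ψ` (`_false_without_convex/_box/_size/_pairwise`) verbatim in its quantifier prefix; the
error exponent is `log^t` exactly (`cellParityLaw_false_logSucc`: `log^{t+1}` is false at `t = 1`), the fibre laws
carry `N/log^t N` and the `Λ`-laws `N (log N)^{|k|−t}`; the top model cell `A_u(N) = 0` (`modelCell_top_eq_zero`)
is why `FibreMassLaw` demands `C_{j[i↦u]} ≤ ε(H_iX/log N + N/log^t N)` — true, the top fibre cell having relative
density `O((log L/log N)^{u−1})`. No `Negative/` lemma has landed for this crux (nothing to import).
-/

open Finset
open scoped Classical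

noncomputable section

namespace Summit.Parity.GeneralizedHardyLittlewood.Cruxes.CellParityLaw.OneLevelPerEpsilon

open Literature.NumberTheory.Sieve
open Summit.Parity.GeneralizedHardyLittlewood.Theses.LeeYangFibres (CellParityLaw)

/-! ### Vocabulary (abbreviations of the crux's own inlined finsets; no new objects are posited) -/

/-- `m` (an integer value of a form) lies in the `Ω`-cell `c` at roughness `N^{1/u}`: `P⁻(m) > N^{1/u}` and
`Ω(m) = c` — literally the cell predicate inlined in the route decl (`Int.toNat`, so `m ≤ 0` is never in a cell
once `N ≥ 2^u`). [folklore] -/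
def InCell (N u : ℕ) (m : ℤ) (c : ℕ) : Prop :=
  (N : ℝ) ^ ((1 : ℝ) / u) < (Nat.minFac m.toNat : ℝ) ∧ ArithmeticFunction.cardFactors m.toNat = c

/-- The model cell count `A_c(N) = #{m ≤ N : P⁻(m) > N^{1/u}, Ω(m) = c}` of the route decl (note `A_u(N) = 0`:
cdisprove `modelCell_top_eq_zero`). [folklore] -/
def modelCell (N u c : ℕ) : ℕ :=
  ((Icc 1 N).filter (fun m => (N : ℝ) ^ ((1 : ℝ) / u) < (Nat.minFac m : ℝ) ∧
    ArithmeticFunction.cardFactors m = c)).card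

/-- The roughness threshold `z = ⌊N^{1/u}⌋` as a natural number (range of the finite product `fibreH`). [folklore] -/
def roughLevel (N u : ℕ) : ℕ :=
  ⌊(N : ℝ) ^ ((1 : ℝ) / u)⌋₊

variable {t : ℕ}

/-- The joint cell count `C_j(Ψ, K, N, u)` of the route decl. [folklore] -/
def cellCount (Ψ : Fin t → AffLinForm 1) (K : Set (Fin 1 → ℝ)) (N u : ℕ) (j : Fin t → ℕ) : ℕ :=
  ((latticeBox 1 N).filter (fun n => realPoint n ∈ K ∧ ∀ i, InCell N u ((Ψ i).eval n) (j i))).card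

/-- The FIBRE of coordinate `i` in the class `c (mod d)`: lattice points `n ∈ K` with the OTHER forms in their
cells `j k` (`k ≠ i`) and `n ≡ c (mod d)`; no condition on `ψ_i`. For `d` coprime to the leading coefficient of
`ψ_i` and `c` the zero class of `ψ_i`, this is Bombieri's `A(x; d)` for the fibre sequence (all heights `≤ x` are
covered by shrinking the convex `K`). [cite: BombieriRIMS1977, pp. 3-4] -/
def fibreCountAP (Ψ : Fin t → AffLinForm 1) (K : Set (Fin 1 → ℝ)) (N u : ℕ) (i : Fin t)
    (j : Fin t → ℕ) (d : ℕ) (c : ℤ) : ℕ :=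
  ((latticeBox 1 N).filter (fun n => realPoint n ∈ K ∧
      (∀ k, k ≠ i → InCell N u ((Ψ k).eval n) (j k)) ∧ (d : ℤ) ∣ (n 0 - c))).card

/-- The fibre MASS `X⁽ⁱ⁾ = ∑_{m ≥ 1} b⁽ⁱ⁾(m)`: points of `K` with the other forms in their cells and `ψ_i(n) > 0`
(Bombieri's `A(x)`; equal to the `(t−1)`-form cell count of `Ψ₋ᵢ` on the convex set `K ∩ {ψ_i > 0}`). [cite: BombieriRIMS1977, p. 3] -/
def fibreMass (Ψ : Fin t → AffLinForm 1) (K : Set (Fin 1 → ℝ)) (N u : ℕ) (i : Fin t)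
    (j : Fin t → ℕ) : ℕ :=
  ((latticeBox 1 N).filter (fun n => realPoint n ∈ K ∧
      (∀ k, k ≠ i → InCell N u ((Ψ k).eval n) (j k)) ∧ 0 < (Ψ i).eval n)).card

/-- The fibre SEQUENCE `b⁽ⁱ⁾(m) = #{n ∈ K∩ℤ : ψ_i(n) = m, ψ_k(n) ∈ cell j_k ∀ k ≠ i}` (`≤ 1` pointwise since
`ψ̇_i ≠ 0`), the sifted sequence that coordinate-`i` Bombieri consumes. [cite: BombieriRIMS1977, p. 3] -/
def fibreWeight (Ψ : Fin t → AffLinForm 1) (K : Set (Fin 1 → ℝ)) (N u : ℕ) (i : Fin t)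
    (j : Fin t → ℕ) (m : ℕ) : ℕ :=
  ((latticeBox 1 N).filter (fun n => realPoint n ∈ K ∧
      (∀ k, k ≠ i → InCell N u ((Ψ k).eval n) (j k)) ∧ (Ψ i).eval n = (m : ℤ))).card

/-- A class `c (mod d)` is FIBRE-GENERIC for coordinate `i`: no prime `p ∣ d` forces `p ∣ ψ_k(n)` for some
`k ≠ i` on the class (`ψ_k(n) ≡ ψ_k(c) (mod d)` when `n ≡ c`). Only generic classes are compared, so no density
model enters (main-term-free typing). [folklore] -/
def FibreGeneric (Ψ : Fin t → AffLinForm 1) (i : Fin t) (d : ℕ) (c : ℤ) : Prop :=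
  ∀ p : ℕ, p.Prime → p ∣ d → ∀ k, k ≠ i → ¬ ((p : ℤ) ∣ (Ψ k).eval (fun _ => c))

/-- Admissible moduli for coordinate `i`: square-free and coprime to the leading coefficient `ψ̇_i(e₁)` (so that
`d ∣ ψ_i(n)` is one residue class of `n`). Primes dividing another leading coefficient or a "determinant"
`ψ̇_i ψ_k(0) − ψ̇_k ψ_i(0)` are NOT excluded: genericity of the compared classes handles them (cf. triage r1-1 F1:
the `(q, a) = 1` repair of `BVRoughCells`). [folklore] -/
def GoodModulus (Ψ : Fin t → AffLinForm 1) (i : Fin t) (d : ℕ) : Prop :=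
  Squarefree d ∧ ∀ p : ℕ, p.Prime → p ∣ d → ¬ ((p : ℤ) ∣ (Ψ i).coeff 0)

/-- The local density `g_i(p)` of `p ∣ ψ_i` WITHIN the fibre at a prime `p ≤ N^{1/u}`: among the residues
`r (mod p)` on which no other form vanishes (the only residues a fibre point can occupy, the other forms being
`p`-rough), the proportion on which `ψ_i` vanishes; `= (ν_Ψ(p) − ν_{Ψ₋ᵢ}(p))/(p − ν_{Ψ₋ᵢ}(p))`, so that
`(1 − g_i(p))/(1 − 1/p) = β_p(Ψ)/β_p(Ψ₋ᵢ)` exactly (`0/0 = 0` only when the fibre is empty). [cite: BombieriRIMS1977, p. 3 (A₁)] -/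
def fibreDensity (Ψ : Fin t → AffLinForm 1) (i : Fin t) (p : ℕ) : ℝ :=
  (((range p).filter (fun r => (p : ℤ) ∣ (Ψ i).eval (fun _ => (r : ℤ)) ∧
      ∀ k, k ≠ i → ¬ ((p : ℤ) ∣ (Ψ k).eval (fun _ => (r : ℤ))))).card : ℝ) /
    (((range p).filter (fun r => ∀ k, k ≠ i → ¬ ((p : ℤ) ∣ (Ψ k).eval (fun _ => (r : ℤ))))).card : ℝ)

/-- Bombieri's density constant of the fibre sequence, cut at the roughness threshold:
`H_i = ∏_{p ≤ z} (1 − g_i(p))(1 − 1/p)⁻¹ = ∏_{p ≤ z} β_p(Ψ)/β_p(Ψ₋ᵢ)` (the primes `> z` carry density `1/p`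
up to `O(t/p²)` and are left to the remainder; `H_i ∈ {0} ∪ [c(t), C_t (log log N)^{t−1}]`).
[cite: BombieriRIMS1977, p. 5 (definition of H)] -/
def fibreH (Ψ : Fin t → AffLinForm 1) (i : Fin t) (z : ℕ) : ℝ :=
  ∏ p ∈ Nat.primesLE z, (1 - fibreDensity Ψ i p) / (1 - 1 / (p : ℝ))

/-- Bombieri's constant `γ_(k) = (k₁! ⋯ k_r!)/(|k| − 1)!` of the vector weight `Λ_(k) = Λ_{k₁} ∗ ⋯ ∗ Λ_{k_r}`
(same expression as the tree's `Bombieri1976_asymptotic_sieve_vector`). [cite: FriedlanderIwaniecPisa1978, p. 722 Theorem 1] -/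
def vecGamma (ks : List ℕ) : ℝ :=
  ((ks.map Nat.factorial).prod : ℝ) / ((ks.sum - 1).factorial : ℝ)

/-! ### The typed statements of the line -/

/-- **Level `θ` of the `t`-form fibres at roughness `u`, class-comparison form** (the card's `FibreClassBV` with
`t, u` as PARAMETERS, triage r1-1 (iii)/r1-2 (1)): for every `L` and `A`, for `N ≥ N₀`, uniformly over
non-degenerate `Ψ` (`‖Ψ‖_N ≤ L`), convex `K ⊆ [−N,N]`, coordinates `i`, frozen cells `j`, and any two selections
`c, c'` of classes, the sum over admissible moduli `d ≤ N^θ` at which both classes are fibre-generic of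
`|#fibre(n ≡ c_d) − #fibre(n ≡ c'_d)|` is `≤ N (log N)^{−A}`. Main-term free; `t = 1`: trivial (interval);
`t = 2`, `θ < 1/2`: Bombieri–Vinogradov for one shifted rough `Ω`-cell set; `t = 2`, `θ ≥ 1/2`: EH-type;
`t ≥ 3`: open at every `θ`. [cite: BombieriFriedlanderIwaniecActa1986, Theorem 0] -/
def FibreClassLevel (t u : ℕ) (θ : ℝ) : Prop :=
  ∀ (L : ℕ) (A : ℝ), 0 < A → ∃ N₀ : ℕ, ∀ N : ℕ, N₀ ≤ N →
    ∀ Ψ : Fin t → AffLinForm 1, IsNondegenerateSystem Ψ → affLinSize Ψ N ≤ L →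
    ∀ K : Set (Fin 1 → ℝ), Convex ℝ K → K ⊆ realBox 1 N →
    ∀ i : Fin t, ∀ j : Fin t → ℕ, (∀ k, 1 ≤ j k ∧ j k ≤ u) →
    ∀ c c' : ℕ → ℤ,
      ∑ d ∈ (Icc 1 ⌊(N : ℝ) ^ θ⌋₊).filter
          (fun d => GoodModulus Ψ i d ∧ FibreGeneric Ψ i d (c d) ∧ FibreGeneric Ψ i d (c' d)),
          |(fibreCountAP Ψ K N u i j d (c d) : ℝ) - (fibreCountAP Ψ K N u i j d (c' d) : ℝ)|
        ≤ (N : ℝ) / Real.log N ^ A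

/-- **Finite-level `Λ_(k)`-law for the fibres** (the ENGINE's output = Friedlander–Iwaniec Theorem 1 at finite
accuracy `ε'` for all vectors `(k)` with `max k_ν ≥ 2`, `|k| ≤ K₀`, uniformly over the family):
`∑_m b⁽ⁱ⁾(m) Λ_(k)(m) = γ_(k) H_i X⁽ⁱ⁾ (log N)^{|k|−1} ± ε'(H_i X⁽ⁱ⁾ + N/log^{t−1} N)(log N)^{|k|−1}`
(relative yardstick `H_i X`, plus the absolute slack of the natural fibre scale, which absorbs fibres of tiny
mass and the values `≤ N^{1−δ}`). Values of `ψ_i` on `[−N,N]` are `≤ LN`. [cite: FriedlanderIwaniecPisa1978, §4 pp. 739-740] -/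
def FibreLambdaLaw (t u K₀ : ℕ) (ε' : ℝ) : Prop :=
  ∀ L : ℕ, ∃ N₀ : ℕ, ∀ N : ℕ, N₀ ≤ N →
    ∀ Ψ : Fin t → AffLinForm 1, IsNondegenerateSystem Ψ → affLinSize Ψ N ≤ L →
    ∀ K : Set (Fin 1 → ℝ), Convex ℝ K → K ⊆ realBox 1 N →
    ∀ i : Fin t, ∀ j : Fin t → ℕ, (∀ k, 1 ≤ j k ∧ j k ≤ u) →
    ∀ ks : List ℕ, (∃ k ∈ ks, 2 ≤ k) → ks.sum ≤ K₀ →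
      |(∑ m ∈ Icc 1 (L * N),
            (fibreWeight Ψ K N u i j m : ℝ) * (ks.map generalizedVonMangoldt).prod m) -
          vecGamma ks * fibreH Ψ i (roughLevel N u) * (fibreMass Ψ K N u i j : ℝ) *
            Real.log N ^ (ks.sum - 1)|
        ≤ ε' * (fibreH Ψ i (roughLevel N u) * (fibreMass Ψ K N u i j : ℝ) +
            (N : ℝ) / Real.log N ^ (t - 1)) * Real.log N ^ (ks.sum - 1)

/-- **Fibre mass law** (Bombieri's `P_r`-distribution theorem for the fibre sequence, in cell form at roughness
`N^{1/u}`, coordinate `i`, frozen cells `j₋ᵢ`): there are `γ_o, γ_e ≥ 0` with `γ_o + γ_e = 2` ("δ on odd r,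
2 − δ on even r") such that for every `m ∈ [1, u]`,
`C_{j[i ↦ m]} = γ_{σ(m)} · H_i · X⁽ⁱ⁾ · A_m(N)/N ± ε (H_i X⁽ⁱ⁾/log N + N/log^t N)`.
The main term is the model `∏ A/N` of the crux coordinate by coordinate (comparison with the integers up to `N`,
FI p. 740 device; no anatomy of `A_m` needed), and `γ` is FREE — at `t = 1` this needs no prime number theorem.
[cite: BombieriRIMS1977, p. 5 Theorem] -/
def FibreMassLaw (t u : ℕ) (ε : ℝ) : Prop :=
  ∀ L : ℕ, ∃ N₀ : ℕ, ∀ N : ℕ, N₀ ≤ N →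
    ∀ Ψ : Fin t → AffLinForm 1, IsNondegenerateSystem Ψ → affLinSize Ψ N ≤ L →
    ∀ K : Set (Fin 1 → ℝ), Convex ℝ K → K ⊆ realBox 1 N →
    ∀ i : Fin t, ∀ j : Fin t → ℕ, (∀ k, 1 ≤ j k ∧ j k ≤ u) →
      ∃ γo γe : ℝ, 0 ≤ γo ∧ 0 ≤ γe ∧ γo + γe = 2 ∧
        ∀ m : ℕ, 1 ≤ m → m ≤ u →
          |(cellCount Ψ K N u (Function.update j i m) : ℝ) -
              (if Odd m then γo else γe) * fibreH Ψ i (roughLevel N u) *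
                (fibreMass Ψ K N u i j : ℝ) * ((modelCell N u m : ℝ) / N)|
            ≤ ε * (fibreH Ψ i (roughLevel N u) * (fibreMass Ψ K N u i j : ℝ) / Real.log N +
                (N : ℝ) / Real.log N ^ t)

/-- **The relative cell parity law at `t` forms** — the crux `CellParityLaw` with its own quantifier prefix and
Walsh main term, but with the RELATIVE-plus-absolute yardstick `ε (1 + ∏_p β_p(Ψ)) N / log^t N` in place of the
absolute `ε N / log^t N` (the two agree up to `sup_{‖Ψ‖_N ≤ L} ∏_p β_p ≍ (log log N)^{t−1}`; equal for systems
of bounded singular product). This is what coordinatewise Bombieri delivers; the upgrade is `AbsoluteCellsStep`.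
[cite: GreenTao2010, Conj. 1.4 (relative error shape)] -/
def CellParityLawRelAt (t : ℕ) : Prop :=
  ∀ (L u : ℕ), 1 ≤ t → 2 ≤ u → ∀ ε : ℝ, 0 < ε → ∃ N₀ : ℕ, ∀ N : ℕ, N₀ ≤ N →
    ∀ Ψ : Fin t → AffLinForm 1, IsNondegenerateSystem Ψ → affLinSize Ψ N ≤ L →
    ∀ K : Set (Fin 1 → ℝ), Convex ℝ K → K ⊆ realBox 1 N →
    ∃ θ : Finset (Fin t) → ℝ, θ ∅ = 1 ∧ (∀ S, |θ S| ≤ 2) ∧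
      ∀ j : Fin t → ℕ, (∀ i, 1 ≤ j i ∧ j i ≤ u) →
        |(cellCount Ψ K N u j : ℝ) -
            (∑ S : Finset (Fin t), θ S * ∏ i ∈ S, (-1 : ℝ) ^ (j i + 1)) *
              (archFactor Ψ K * singularProduct Ψ * ∏ i, ((modelCell N u (j i) : ℝ) / N))|
          ≤ ε * (1 + singularProduct Ψ) * N / Real.log N ^ t

/-! ### The seven steps of the line, as named propositions

The skeleton audit (`#h21_check_skeleton`) takes as THE skeleton the theorem of this file whose conclusion is the
crux decl by name and allows `sorry` only inside the declared `stub_*` theorems; the steps are therefore typed by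
NAMED propositions and the composing theorem `CellParityLaw_of : CellParityLaw` applies the seven stubs (its
hypothetical form, pure logic in the seven statements, is the `example` next to it). -/

/-- E1 — THE ENGINE as a named proposition: uniform finite-level Bombieri (vector weights) for fibres,
"one level `θ₀(t, u, K₀, ε') < 1` per accuracy". [cite: FriedlanderIwaniecPisa1978, §4 pp. 739-740] -/
def FiniteLevelStep : Prop :=
  ∀ (t u K₀ : ℕ) (ε' : ℝ), 1 ≤ t → 2 ≤ u → 0 < ε' →
    ∃ θ₀ : ℝ, θ₀ < 1 ∧ (FibreClassLevel t u θ₀ → FibreLambdaLaw t u K₀ ε')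

/-- E2 — CELL COMPLETENESS as a named proposition: finitely many `Λ_(k)`-laws of accuracy `ε'` give the `Ω`-cell
law up to parity with accuracy `ε`. [cite: BombieriRIMS1977, p. 5 Theorem; FriedlanderIwaniecPisa1978, p. 723 Remark 4] -/
def CellCompletenessStep : Prop :=
  ∀ (t u : ℕ) (ε : ℝ), 1 ≤ t → 2 ≤ u → 0 < ε →
    ∃ K₀ : ℕ, ∃ ε' : ℝ, 0 < ε' ∧ (FibreLambdaLaw t u K₀ ε' → FibreMassLaw t u ε)

/-- L1 — the Bombieri–Vinogradov rung for fibres conditioned on at most ONE form (`t ≤ 2`, `θ < 1/2`);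
provable now. [cite: BombieriFriedlanderIwaniecActa1986, Theorem 0] -/
def PairFibreBV : Prop :=
  ∀ t : ℕ, 1 ≤ t → t ≤ 2 → ∀ u : ℕ, 2 ≤ u → ∀ θ : ℝ, θ < 1 / 2 → FibreClassLevel t u θ

/-- L2 — the Elliott–Halberstam-type rungs for fibres conditioned on at most one form (`t ≤ 2`, `1/2 ≤ θ < 1`);
open, GEH-strength. [cite: arXiv14074897, Claim 2.6 (GEH)] -/
def PairFibreLevel : Prop :=
  ∀ t : ℕ, 1 ≤ t → t ≤ 2 → ∀ u : ℕ, 2 ≤ u → ∀ θ : ℝ, 1 / 2 ≤ θ → θ < 1 → FibreClassLevel t u θ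

/-- L3 — every rung for MULTI-FORM fibres (`t ≥ 3`, `θ < 1`): equidistribution of intersections of `≥ 2`
shifted rough cell sets among generic classes; open at every level (the card's gap, triage X2). [this line] -/
def MultiFibreLevel : Prop :=
  ∀ t : ℕ, 3 ≤ t → ∀ u : ℕ, 2 ≤ u → ∀ θ : ℝ, θ < 1 → FibreClassLevel t u θ

/-- W — the WALSH INDUCTION STEP as a named proposition (base `t = 1` included: the premiss on `t' < t` is then
vacuous): coordinatewise fibre mass laws + the relative law for fewer forms ⇒ the relative law at `t` forms
(triage X1 structure lemma: tensor all of whose coordinate fibres are parity-affine, Walsh inversion with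
positivity, `θ_∅ = 1` from `γ_o + γ_e = 2`, singular-series factorisation `H_i 𝔖(Ψ₋ᵢ) ∼ 𝔖(Ψ)`). [this line] -/
def WalshStep : Prop :=
  ∀ t : ℕ, 1 ≤ t → (∀ u : ℕ, 2 ≤ u → ∀ ε : ℝ, 0 < ε → FibreMassLaw t u ε) →
    (∀ t' : ℕ, 1 ≤ t' → t' < t → CellParityLawRelAt t') → CellParityLawRelAt t

/-- R — the DECLARED RESIDUAL as a named proposition (so that `stub_absoluteCells` is not read as "a theorem
concluding the crux"): relative ⇒ absolute cells, i.e. the uniformity of the law on the systems with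
`∏_p β_p(Ψ) → ∞` (`≍ (log log N)^{t−1}` at worst). Cell-level twin of the route item `AbsoluteUpgrade`; moot if
the route consumes `CellParityLawRelAt`. [this line] -/
def AbsoluteCellsStep : Prop :=
  (∀ t : ℕ, CellParityLawRelAt t) → CellParityLaw

/-! ### Sorry-free sanity lemmas -/

/-- Monotonicity of the class-comparison level in `θ` (a sub-sum of non-negative terms; cf. the tree's
`SieveSequence.BombieriA2At.mono`). [folklore] -/
theorem fibreClassLevel_mono {t u : ℕ} {θ θ' : ℝ} (h : FibreClassLevel t u θ) (hle : θ' ≤ θ) :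
    FibreClassLevel t u θ' := by
  intro L A hA
  obtain ⟨N₀, hN₀⟩ := h L A hA
  refine ⟨max N₀ 1, fun N hN Ψ hΨ hsz K hK hKb i j hj c c' => ?_⟩
  have hN1 : (1 : ℝ) ≤ N := by exact_mod_cast le_of_max_le_right hN
  refine le_trans (Finset.sum_le_sum_of_subset_of_nonneg ?_ fun _ _ _ => abs_nonneg _)
    (hN₀ N (le_of_max_le_left hN) Ψ hΨ hsz K hK hKb i j hj c c')
  refine Finset.filter_subset_filter _ (Finset.Icc_subset_Icc le_rfl ?_)
  exact Nat.floor_mono (Real.rpow_le_rpow_of_exponent_le hN1 hle)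

/-- L1 is the `θ ≤ 1/2` shadow of L2 (recorded so that nobody mistakes the BV stub for independent content: it is
kept as a separate stub because it is the UNCONDITIONALLY provable rung). [folklore] -/
theorem pairFibreBV_of_pairFibreLevel (h : PairFibreLevel) : PairFibreBV :=
  fun t ht ht2 u hu θ hθ =>
    fibreClassLevel_mono (h t ht ht2 u hu (1 / 2) le_rfl (by norm_num)) hθ.le

/-- The relative law at `t = 0` forms is vacuous (its prefix carries `1 ≤ t`). [folklore] -/
theorem cellParityLawRelAt_zero : CellParityLawRelAt 0 :=
  fun _ _ h => absurd h (by norm_num)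

/-! ### Registered stubs -/

/-- STUB E1 — the finite-level engine (`FiniteLevelStep`). Plan: package the fibre as a `SieveSequence`
(`a := fibreWeight`, Bombieri normalisation `size := congrSum 1`, density `g_i` = `fibreDensity` on primes `≤ z`,
`1/p` above, multiplicative on square-free moduli); (A₂) at level `N^{θ₀}` from `FibreClassLevel` (zero class of
`ψ_i` vs. the average generic class; non-generic classes are empty for `p ≤ z` and carry `O(tN/p)` for `p > z`;
moduli with a prime `∣ ψ̇_i` or `> z` bad are handled trivially); (A₁), (A₃) (`|r_d| ≤ 2N/d + 1`, and
`N/X ≤ 2ε'⁻¹ log^t N` or the conclusion is within the slack), (A₄), (A₅) (`g_i(p) − 1/p = O(t/p²)`) with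
family-uniform constants; then FI §4 for vectors at finite level — the tree's `BombieriSieve.coreV` /
`core_finiteLevel` / `FI1978_lemma11_uniform` / `FI1978_lemma12_uniform` re-run with explicit dependence, and the
comparison sequence `1_{[1,N]}` for the main term. All error terms are relative to `H_i X` (Σ₀ ~ `v⁴`, Σ₂ ~
`2^{k+1}v`, Σ₁ ~ `u⁸e^{−u}`), which is why `H_i ≍ log log N` on discriminant-rich systems is harmless HERE.
Size XL (triage r1-1 F2, r1-3 X4). [cite: FriedlanderIwaniecPisa1978, §4 pp. 739-740; BombieriRIMS1977, pp. 3-5] -/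
theorem stub_finiteLevel : FiniteLevelStep := by
  sorry

/-- STUB E2 — cell completeness (`CellCompletenessStep`). Plan: Bombieri's deduction of the `P_r` law from
Theorem 1 for vectors, at finite accuracy: the fibre sequence is `{0,1}`-valued, `Λ_(k)` vanishes off
`ω ≤ |k|`, moments `∑ b(m) ∏ Λ(p_ν)(log p_ν)^{a_ν}` over `m = p₁⋯p_r ≤ LN` from the vector laws (tree:
`BombieriP2` namespace — parity functional, `univ`, `moment`, `poly_moment`, Weierstrass — for `r = 2`),
polynomial test functions on `T_r` approximating `1{u₁ > 1/u}` from above and below, boundary layer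
`P⁻(m) ∈ (N^{1/u−η}, N^{1/u+η}]` and the top cell by POSITIVE majorants (so `b ≥ 0` suffices), prime powers by
the trivial bound; constants `γ_o + γ_e = 2` exact after renormalising inside the error; model `A_m(N)/N` by
running the same identities for `1_{[1,N]}` (`H = 1`, `X = N`). Size L–XL (all `r ≤ u`).
[cite: BombieriRIMS1977, p. 5 Theorem and p. 6; FriedlanderIwaniecPisa1978, p. 723 Remark 4] -/
theorem stub_cellCompleteness : CellCompletenessStep := by
  sorry

/-- STUB L1 — Bombieri–Vinogradov rung, `t ≤ 2`, `θ < 1/2` (`PairFibreBV`). `t = 1`: the fibre is `K ∩ ℤ`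
(an interval), two classes mod `d` differ by `≤ 1`, sum `≤ N^θ`. `t = 2`: the fibre of coordinate `i` is
`{n ∈ K : ψ_k(n) ∈ cell j_k}` for the single `k ≠ i`; `n ≡ c (d)` ⇔ `ψ_k(n) ≡ ψ_k(c) (mod d)` for `(d, ψ̇_k) = 1`
(primes `∣ ψ̇_k ≤ L` contribute boundedly many local factors), so this is Bombieri–Vinogradov with TWO generic
classes for the set of products of exactly `j_k` primes `> N^{1/u}` of size `≤ LN` in an interval and a fixed
progression mod `ψ̇_k`: Vaughan/Heath-Brown-free — the set IS a convolution of `j_k ≤ u` prime indicators each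
`> N^{1/u} ≥ x^ε`, so Siegel–Walfisz in one factor + the bilinear large sieve (tree
`BombieriFriedlanderIwaniecTheorem0b_holds`, `largeSieve_bilinear`; `j_k = 1`: `bombieri_vinogradov_holds`).
PROVABLE NOW; size M–L. [cite: BombieriFriedlanderIwaniecActa1986, Theorem 0] -/
theorem stub_pairFibreBV : PairFibreBV := by
  sorry

/-- STUB L2 — Elliott–Halberstam-type rungs, `t ≤ 2`, `1/2 ≤ θ < 1` (`PairFibreLevel`): the same sets, moduli
up to `N^θ`, maximum over two generic classes, saving every power of `log`. GEH-strength (Polymath 8b Claim 2.6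
shape for the convolution of prime indicators); OPEN for every `θ ≥ 1/2`: the moduli that matter are products of
primes in `(N^{δ^{4/3}}, N^θ]` in a FIXED class — `Literature.Barriers.Parity.LargeSieveLevelHalf` bites and no
well-factorable/smooth-modulus evasion applies to the absolute-value form (triage r1-3 (b): a partial rung
`1/2 + η(u)` is plausible only for the SIGNED remainders of card `composite-fibres-first`). Believed (square-root
heuristic with room `N^{(1−θ)/2}`); consistent with Friedlander–Granville (irregularities only at `x/(log x)^B`).
[cite: arXiv14074897, Claim 2.6; BombieriFriedlanderIwaniecActa1986, §1] -/
theorem stub_pairFibreLevel : PairFibreLevel := by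
  sorry

/-- STUB L3 — multi-form fibres, `t ≥ 3`, every `θ < 1` (`MultiFibreLevel`): e.g. for `Ψ = (n, n+2, n+6)`,
`i = 0`, the fibre `{n : n+2 ∈ cell, n+6 ∈ cell}` must be equidistributed among the generic classes mod `d` on
average over `d ≤ N^θ`. HARDEST stub: open at every level, even for ONE bounded modulus beyond what the crux's own
`L`-uniformity gives (restricting to `n ≡ c (mod d)` multiplies the coefficients by `d`), because the fibre is an
intersection of `≥ 2` shifted cell sets (prime-pair type); relative statements are not known either (upper and
lower bound sieves differ at fixed `u`). Under it the triple sieve constant improves from `4²·2! = 32` (BV + a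
2-dimensional Selberg sieve) to `2³` (triage F4/X5 calibration: the crux at `(t, u) = (3, 2)` already needs `≤ 15`).
[this line] -/
theorem stub_multiFibreLevel : MultiFibreLevel := by
  sorry

/-- STUB W — the Walsh induction step (`WalshStep`); PROVABLE NOW, size M–L. For `t ≥ 2` and each `i`: the fibre
mass `X⁽ⁱ⁾_{j₋ᵢ}` IS `cellCount (Ψ ∘ i.succAbove) (K ∩ {x | 0 < (Ψ i).realEval x}) N u (j ∘ i.succAbove)`
(convex, in the box, size `≤ L`, non-degenerate), so the premiss at `t − 1` evaluates it as
`W⁽⁻ⁱ⁾(σ₋ᵢ)·arch·𝔖(Ψ₋ᵢ)·∏_{k≠i} A_{j_k}/N ± ε(1 + 𝔖(Ψ₋ᵢ))N/log^{t−1}N`; `arch(Ψ₋ᵢ, K_i) = arch(Ψ, K)`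
(cells force `ψ_i > 0`) and `H_i·β-product: ∏_{p ≤ z} β_p(Ψ)/β_p(Ψ₋ᵢ) = 𝔖(Ψ)/𝔖(Ψ₋ᵢ)·(1 + O(t²/z))`
(`localFactor`, `tendsto_singularProductPartial`; `𝔖(Ψ₋ᵢ) ∈ {0} ∪ [c(t), ∞)`); hence
`T_j := C_j/(arch 𝔖(Ψ) ∏A/N)` depends on each `j_i` only through its parity ⇒ `T = W(σ(j))`, a Walsh polynomial;
`γ_o + γ_e = 2` for every `i` ⇒ Walsh mean `= θ⁽⁻ⁱ⁾_∅ = 1` (exactly, after moving the defect into the error);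
`C_j ≥ 0` ⇒ `W ≥ −o(1)` ⇒ `|θ_S| ≤ 1 + o(1) ≤ 2`. Error bookkeeping with the relative yardsticks closes because
`H_i (1 + 𝔖(Ψ₋ᵢ)) ≤ C(t)(1 + 𝔖(Ψ))` and `A_m(N) ≤ C_u N/log N` (upper bounds only; the top cell `m = u` has
model `0` and fibre-law error `ε H_i X/log N ≤ ε C (1+𝔖)N/log^t N`). `t = 1`: `X = #(K∩ℤ ∩ {ψ > 0}) = arch ± 1`,
`H = ψ̇/φ(ψ̇) = 𝔖(ψ)` (or both `0`), `θ_∅ = 1`, `θ_{0} = (γ_o − γ_e)/2`. `u = 2`: only the all-odd cells carry a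
model (`A₂(N) = 0`) and `W` is read off the `γ_o`'s. [cite: BombieriRIMS1977, p. 5; GreenTao2010, Lemma 1.3] -/
theorem stub_walsh : WalshStep := by
  sorry

/-- STUB R — the declared residual (`AbsoluteCellsStep`): from `ε(1 + ∏_pβ_p)N/log^t N` to `εN/log^t N` on the
systems with `∏_p β_p(Ψ) → ∞` (shifts divisible by `∏_{p ≤ y} p`, `y → ∞`; at worst `(log log N)^{t−1}`). NOT
addressed by the mechanism: a finite level gives a fixed RELATIVE accuracy, and `sup ∏β_p` is unbounded, so the
absolute crux needs level `N^{1 − c/(log log N)^{3(t−1)}}` → 1 (beyond every fixed `θ`, though far inside the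
square-root heuristic and below the Friedlander–Granville range). True if the crux is; equal in kind to the route's
`AbsoluteUpgrade`. Recommended repair is at ROUTE level (consume `CellParityLawRelAt`), see the line card.
[cite: GreenTao2010, Conj. 1.4; Ford2004, Theorem 1] -/
theorem stub_absoluteCells : AbsoluteCellsStep := by
  sorry

/-! ### Composition (kernel-checked; `sorry` enters only through the seven `stub_*`) -/

/-- Every level `θ < 1` of every fibre family from the three level steps, by cases on `t ≤ 2 / t ≥ 3` and
`θ < 1/2 / θ ≥ 1/2`. [this line] -/
theorem fibreClassLevel_of_steps (hBV : PairFibreBV) (hEH : PairFibreLevel) (hM : MultiFibreLevel)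
    {t u : ℕ} (ht : 1 ≤ t) (hu : 2 ≤ u) {θ : ℝ} (hθ : θ < 1) : FibreClassLevel t u θ := by
  rcases Nat.lt_or_ge t 3 with ht3 | ht3
  · have ht2 : t ≤ 2 := by omega
    rcases lt_or_ge θ (1 / 2) with hlo | hhi
    · exact hBV t ht ht2 u hu θ hlo
    · exact hEH t ht ht2 u hu θ hhi hθ
  · exact hM t ht3 u hu θ hθ

/-- The fibre mass law at every `(t, u, ε)`: `(K₀, ε')` from E2, `θ₀` from E1, the level from L1–L3. [this line] -/
theorem fibreMassLaw_of_steps (hE : FiniteLevelStep) (hC : CellCompletenessStep) (hBV : PairFibreBV)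
    (hEH : PairFibreLevel) (hM : MultiFibreLevel) {t u : ℕ} (ht : 1 ≤ t) (hu : 2 ≤ u) {ε : ℝ}
    (hε : 0 < ε) : FibreMassLaw t u ε := by
  obtain ⟨K₀, ε', hε', hCC⟩ := hC t u ε ht hu hε
  obtain ⟨θ₀, hθ₀, hEE⟩ := hE t u K₀ ε' ht hu hε'
  exact hCC (hEE (fibreClassLevel_of_steps hBV hEH hM ht hu hθ₀))

/-- The relative law at every `t`, by strong induction on `t` through the Walsh step. [this line] -/
theorem cellParityLawRelAt_of_steps (hE : FiniteLevelStep) (hC : CellCompletenessStep) (hBV : PairFibreBV)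
    (hEH : PairFibreLevel) (hM : MultiFibreLevel) (hW : WalshStep) : ∀ t : ℕ, CellParityLawRelAt t :=
  fun t => Nat.strong_induction_on t fun t ih => by
    rcases Nat.eq_zero_or_pos t with rfl | ht
    · exact cellParityLawRelAt_zero
    · exact hW t ht (fun u hu ε hε => fibreMassLaw_of_steps hE hC hBV hEH hM ht hu hε)
        (fun t' _ hlt => ih t' hlt)

/-- THE SKELETON: the seven registered stubs compose to the crux
`Summit.Parity.GeneralizedHardyLittlewood.Theses.LeeYangFibres.CellParityLaw` BY NAME. This declaration contains
no `sorry` of its own; it is closed exactly when the seven stubs are. [this line] -/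
theorem CellParityLaw_of : CellParityLaw :=
  (show AbsoluteCellsStep from stub_absoluteCells)
    (cellParityLawRelAt_of_steps stub_finiteLevel stub_cellCompleteness stub_pairFibreBV
      stub_pairFibreLevel stub_multiFibreLevel stub_walsh)

/-- The hypothetical form of the composition — pure logic in the seven stub STATEMENTS, no stub used (an
`example`, so that `CellParityLaw_of` stays the unique declaration concluding the crux). -/
example : FiniteLevelStep → CellCompletenessStep → PairFibreBV → PairFibreLevel → MultiFibreLevel →
    WalshStep → AbsoluteCellsStep → CellParityLaw :=
  fun hE hC hBV hEH hM hW hA =>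
    (show (∀ t : ℕ, CellParityLawRelAt t) → CellParityLaw from hA)
      (cellParityLawRelAt_of_steps hE hC hBV hEH hM hW)

-- audit: the conclusion is the route decl itself
#check (CellParityLaw_of : Summit.Parity.GeneralizedHardyLittlewood.Theses.LeeYangFibres.CellParityLaw)

end Summit.Parity.GeneralizedHardyLittlewood.Cruxes.CellParityLaw.OneLevelPerEpsilon

end
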